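import Summits.MatrixMultiplication.MatrixMultiplication.Theorems.ObstructionDescentUniversalOccurrenceTwoRectangleTwoRowTableaux

set_option linter.dupNamespace false
set_option autoImplicit false

/-!
# Universal occurrence — two rectangles, ALL TWO-ROW TYPES, part M: arithmetic of `k` column pairs (decomp-mm · lens 3 · gen 43)

Route `route-MatrixMultiplication-ObstructionDescent` (sub-problem `MatrixMultiplication`, `ω(ℂ) = 2`); SUPPORT for the crux
`NoOccurrenceObstruction` (`P_O`, item `stmt-MatrixMultiplication-29040`) through the universal-occurrence programme (NODE-g29…g43
of the decomp-mm cell, lens 3).  Nothing here proves `ω = 2` or closes an item; no `def`, no `sorry`, standard axioms.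

**This file (elementary, shape-free).**  `sum_range_double`, `sum_slots_pairs_eq`: regrouping a sum over the slots `< 2k` into `k`
pairs; `sum_oddIndicator_eq`: the colouring `g = (0,1,0,1,…,0,1,0,0,…)` (`k` ones) has `Σ g = k`; `antiPairs_card_even`: the PARITY
LAW for `k` pairs of height `2` — if every pair `j < k` is a twin (`B'_j = A_j`, `A'_j + A_j = 1`) or an anti-twin (`B'_j ≠ A_j`,
`A'_j = A_j`) and `Σ_j (A_j + A'_j) = k`, then the number of anti-twins is even; `swapList_apply_*`, `sign_swapList`: a product of
disjoint transpositions indexed by a list — its values and its sign `(-1)^{length}`.  Used in part N (`twoRow_value_eq_one`).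

[cite: BurgisserIkenmeyer2011, §3.4 (Prop. 3.4), Thm. 4.4] [cite: BurgisserIkenmeyer2017, §5, Thm. 5.9 (proof of (2)), eq. (3.4)]
-/

noncomputable section

open scoped BigOperators

namespace Summit.MatrixMultiplication.MatrixMultiplication.Theorems.ObstructionCalculus

/-! ### §1 Regrouping sums over the slots -/

/-- `Σ_{n < 2k} f(n) = Σ_{j < k} (f(2j) + f(2j+1))`. [folklore] -/
theorem sum_range_double (f : ℕ → ℕ) (k : ℕ) :
    ∑ n ∈ Finset.range (2 * k), f n = ∑ j ∈ Finset.range k, (f (2 * j) + f (2 * j + 1)) := by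
  induction k with
  | zero => simp
  | succ k ih =>
    have e : 2 * (k + 1) = 2 * k + 1 + 1 := by ring
    rw [e, Finset.sum_range_succ f (2 * k + 1), Finset.sum_range_succ f (2 * k), ih,
      Finset.sum_range_succ (fun j => f (2 * j) + f (2 * j + 1)) k, add_assoc]

/-- A function on the slots vanishing from slot `2k` on sums to its values on the `k` slot pairs. [folklore] -/
theorem sum_slots_pairs_eq {N k : ℕ} (hk : 2 * k ≤ N) (a : Fin N → ℕ) (h : ∀ s : Fin N, 2 * k ≤ (s : ℕ) → a s = 0) :
    ∑ s, a s = ∑ j ∈ Finset.range k,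
      ((if hj : 2 * j < N then a ⟨2 * j, hj⟩ else 0) + (if hj : 2 * j + 1 < N then a ⟨2 * j + 1, hj⟩ else 0)) := by
  classical
  let a' : ℕ → ℕ := fun n => if hn : n < N then a ⟨n, hn⟩ else 0
  have ha' : ∀ s : Fin N, a s = a' s := fun s => by simp [a']
  have h1 : ∑ s : Fin N, a s = ∑ i ∈ Finset.range N, a' i := by
    rw [← Fin.sum_univ_eq_sum_range]
    exact Finset.sum_congr rfl (fun s _ => ha' s)
  have h2 : ∑ i ∈ Finset.range (2 * k), a' i = ∑ i ∈ Finset.range N, a' i := by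
    apply Finset.sum_subset (fun x hx => Finset.mem_range.2 (lt_of_lt_of_le (Finset.mem_range.1 hx) hk))
    intro x hx hx2
    rw [Finset.mem_range] at hx hx2
    simp only [a', dif_pos hx]
    exact h _ (by simp; omega)
  rw [h1, ← h2, sum_range_double]

/-- The colouring with `k` ones at the odd slots `< 2k` has total `k`. [folklore] -/
theorem sum_oddIndicator_eq {N k : ℕ} (hk : 2 * k ≤ N) (a : Fin N → ℕ)
    (ha : ∀ s : Fin N, a s = if ((s : ℕ) < 2 * k ∧ (s : ℕ) % 2 = 1) then 1 else 0) : ∑ s, a s = k := by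
  rw [sum_slots_pairs_eq hk a (fun s hs => by rw [ha, if_neg (by omega)])]
  have h : ∀ j ∈ Finset.range k,
      ((if hj : 2 * j < N then a ⟨2 * j, hj⟩ else 0) + (if hj : 2 * j + 1 < N then a ⟨2 * j + 1, hj⟩ else 0)) = 1 := by
    intro j hj
    rw [Finset.mem_range] at hj
    rw [dif_pos (by omega), dif_pos (by omega), ha, ha, if_neg (by dsimp only; omega),
      if_pos (by dsimp only; omega)]
  rw [Finset.sum_congr rfl h]
  simp

/-! ### §2 The parity law for pairs of height two -/

/-- **Parity law.**  Pairs `j < k` with letters `A_j, A'_j, B'_j`: each pair is a twin (`B'_j = A_j`, `A'_j + A_j = 1`) or an anti-twin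
(`B'_j ≠ A_j`, `A'_j = A_j`); if `Σ_j (A_j + A'_j) = k` then the number of anti-twins is even (`= 2 Σ_{anti} A_j`). [folklore] -/
theorem antiPairs_card_even (k : ℕ) (A A' B' : ℕ → ℕ)
    (hcase : ∀ j < k, (B' j = A j ∧ A' j + A j = 1) ∨ (B' j ≠ A j ∧ A' j = A j))
    (hsum : ∑ j ∈ Finset.range k, (A j + A' j) = k) :
    Even ((Finset.range k).filter (fun j => B' j ≠ A j)).card := by
  classical
  set U := (Finset.range k).filter (fun j => B' j ≠ A j) with hU
  set W := (Finset.range k).filter (fun j => ¬ B' j ≠ A j) with hW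
  have hsplit := Finset.sum_filter_add_sum_filter_not (Finset.range k) (fun j => B' j ≠ A j) (fun j => A j + A' j)
  rw [hsum] at hsplit
  have hUsum : ∑ j ∈ U, (A j + A' j) = 2 * ∑ j ∈ U, A j := by
    rw [Finset.mul_sum]
    apply Finset.sum_congr rfl
    intro j hj
    obtain ⟨hjk, hja⟩ := Finset.mem_filter.1 hj
    rw [Finset.mem_range] at hjk
    rcases hcase j hjk with ⟨h1, -⟩ | ⟨-, h2⟩
    · exact absurd h1 hja
    · rw [h2]; ring
  have hWsum : ∑ j ∈ W, (A j + A' j) = W.card := by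
    rw [Finset.card_eq_sum_ones]
    apply Finset.sum_congr rfl
    intro j hj
    obtain ⟨hjk, hja⟩ := Finset.mem_filter.1 hj
    rw [Finset.mem_range] at hjk
    rcases hcase j hjk with ⟨-, h1⟩ | ⟨h2, -⟩
    · omega
    · exact absurd h2 hja
  have hcard := Finset.card_filter_add_card_filter_not (s := Finset.range k) (fun j => B' j ≠ A j)
  rw [Finset.card_range] at hcard
  rw [← hU] at hsplit hcard
  rw [← hW] at hsplit hcard
  rw [hUsum, hWsum] at hsplit
  exact ⟨∑ j ∈ U, A j, by omega⟩

/-! ### §3 Products of disjoint transpositions -/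

/-- A product of disjoint transpositions `∏_{j ∈ L} (a_j b_j)` exchanges `a_j` and `b_j` for `j ∈ L`. [folklore] -/
theorem swapList_apply_pair {M : ℕ} (a b : ℕ → Fin M) (L : List ℕ) (hL : L.Nodup)
    (hab : ∀ i ∈ L, ∀ j ∈ L, a i ≠ b j) (ha : ∀ i ∈ L, ∀ j ∈ L, a i = a j → i = j)
    (hb : ∀ i ∈ L, ∀ j ∈ L, b i = b j → i = j) :
    (∀ j ∈ L, (L.map fun j => Equiv.swap (a j) (b j)).prod (a j) = b j ∧
      (L.map fun j => Equiv.swap (a j) (b j)).prod (b j) = a j) ∧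
    (∀ p : Fin M, (∀ j ∈ L, p ≠ a j ∧ p ≠ b j) → (L.map fun j => Equiv.swap (a j) (b j)).prod p = p) := by
  induction L with
  | nil => simp
  | cons i L ih =>
    obtain ⟨hiL, hL'⟩ := List.nodup_cons.1 hL
    have m0 : i ∈ i :: L := List.mem_cons_self
    have mL : ∀ j ∈ L, j ∈ i :: L := fun j hj => List.mem_cons_of_mem i hj
    obtain ⟨ih1, ih2⟩ := ih hL' (fun x hx y hy => hab x (mL x hx) y (mL y hy))
      (fun x hx y hy => ha x (mL x hx) y (mL y hy)) (fun x hx y hy => hb x (mL x hx) y (mL y hy))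
    simp only [List.map_cons, List.prod_cons, Equiv.Perm.mul_apply]
    refine ⟨fun j hj => ?_, fun p hp => ?_⟩
    · rcases List.mem_cons.1 hj with rfl | hj
      · have hfa : (L.map fun j => Equiv.swap (a j) (b j)).prod (a j) = a j :=
          ih2 _ (fun x hx => ⟨fun h => hiL (by rw [ha j m0 x (mL x hx) h]; exact hx), hab j m0 x (mL x hx)⟩)
        have hfb : (L.map fun j => Equiv.swap (a j) (b j)).prod (b j) = b j :=
          ih2 _ (fun x hx => ⟨fun h => hab x (mL x hx) j m0 h.symm,
            fun h => hiL (by rw [hb j m0 x (mL x hx) h]; exact hx)⟩)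
        rw [hfa, hfb, Equiv.swap_apply_left, Equiv.swap_apply_right]
        exact ⟨rfl, rfl⟩
      · have hne : i ≠ j := fun h => hiL (h ▸ hj)
        obtain ⟨e1, e2⟩ := ih1 j hj
        rw [e1, e2]
        refine ⟨Equiv.swap_apply_of_ne_of_ne (fun h => hab i m0 j (mL j hj) h.symm)
            (fun h => hne (hb j (mL j hj) i m0 h).symm), Equiv.swap_apply_of_ne_of_ne
            (fun h => hne (ha j (mL j hj) i m0 h).symm) (fun h => hab j (mL j hj) i m0 h)⟩
    · rw [ih2 p (fun j hj => hp j (mL j hj))]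
      exact Equiv.swap_apply_of_ne_of_ne (hp i m0).1 (hp i m0).2

/-- The sign of a product of `|L|` transpositions is `(-1)^{|L|}`. [folklore] -/
theorem sign_swapList {M : ℕ} (a b : ℕ → Fin M) (L : List ℕ) (hab : ∀ j ∈ L, a j ≠ b j) :
    Equiv.Perm.sign (L.map fun j => Equiv.swap (a j) (b j)).prod = (-1) ^ L.length := by
  induction L with
  | nil => simp
  | cons i L ih =>
    rw [List.map_cons, List.prod_cons, Equiv.Perm.sign_mul,
      Equiv.Perm.sign_swap (hab i List.mem_cons_self), ih (fun j hj => hab j (List.mem_cons_of_mem i hj)),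
      List.length_cons]
    exact (pow_succ' _ _).symm

end Summit.MatrixMultiplication.MatrixMultiplication.Theorems.ObstructionCalculus
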